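import Mathlib

/-!
# Galois descent of SUBSPACES of `K ⊗[F₀] V` for a finite Galois extension `K/F₀` (the «subspace form» left open
by T3.4's kernel notes)

Blind re-derivation cell `pub-hodge-repro`, seat `t3-p4` (Tier 3, T3.5 for T3.4).  Target tree path
`lean/Summits/Ventures/HodgeRepro/Tier3SubspaceDescent.lean`; Mathlib only.

`Tier3GaloisDescent.lean` descends INVARIANT VECTORS (`(σ ⊗ 1) w = w` for all `σ` ⇒ `w = 1 ⊗ v`), which is all
LEMMA-R-RESIDUE.md v5 uses.  This file proves the stronger classical statement (Speiser's lemma / Galois descent for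
vector spaces): a `K`-subspace `U ≤ K ⊗[F₀] V` stable under every `σ ⊗ 1`, `σ ∈ Gal(K/F₀)`, is the base change of its
`F₀`-rational part `U₀ := {v ∈ V : 1 ⊗ v ∈ U}` — `baseChange_rationalPart_eq`.  Proof (the trace argument): for
`u ∈ U` and `a ∈ K` the averaged vector `Σ_σ (σ ⊗ 1)(a • u)` lies in `U`, is Galois-invariant, and equals
`1 ⊗ θ(a • u)` where `θ := TensorProduct.lift ((LinearMap.lsmul F₀ V).comp (Algebra.trace F₀ K))`, `θ(c ⊗ v) = Tr_{K/F₀}(c) • v`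
(`sum_rTensor_eq_tmul_traceContract`; `θ` is written out, no definition is introduced); expanding the coefficients of
`u` in the trace-dual basis of a basis `k` of `K/F₀` (`Module.Basis.traceDual`, non-degeneracy of the trace form of a
separable extension) gives `u = Σ_j k^*_j • (1 ⊗ θ(k_j • u))` (`eq_sum_traceDual_smul_tmul_traceContract`), a
`K`-combination of rational vectors of `U`.

HONESTY.  Linear algebra on Mathlib; nothing here is about Hodge classes.  HC_CM is NOT proved by anyone in this
repository.
-/

set_option autoImplicit false

open TensorProduct

namespace HodgeRepro.Tier3

variable {F₀ K : Type*} [Field F₀] [Field K] [Algebra F₀ K]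
variable {V : Type*} [AddCommGroup V] [Module F₀ V]

/-- The `F₀`-linear «trace contraction» `θ := TensorProduct.lift ((LinearMap.lsmul F₀ V).comp (Algebra.trace F₀ K)) :
K ⊗[F₀] V → V` sends `c ⊗ v` to `Tr_{K/F₀}(c) • v` (stated for the explicit `lift`; no new definition is introduced). -/
theorem lift_lsmul_comp_trace_tmul (c : K) (v : V) :
    TensorProduct.lift ((LinearMap.lsmul F₀ V).comp (Algebra.trace F₀ K)) (c ⊗ₜ[F₀] v) =
      Algebra.trace F₀ K c • v := rfl

/-- `σ ⊗ 1` is `σ`-semilinear for the `K`-scalars of `K ⊗[F₀] V`: `(σ ⊗ 1)(a • u) = σ a • (σ ⊗ 1) u`. -/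
theorem rTensor_smul (σ : K ≃ₐ[F₀] K) (a : K) (u : K ⊗[F₀] V) :
    LinearMap.rTensor V σ.toLinearMap (a • u) = σ a • LinearMap.rTensor V σ.toLinearMap u := by
  induction u using TensorProduct.induction_on with
  | zero => simp
  | tmul c v => simp [TensorProduct.smul_tmul', map_mul]
  | add x y hx hy => simp only [smul_add, map_add, hx, hy]

variable [FiniteDimensional F₀ K] [IsGalois F₀ K]

/-- The Galois average `Σ_σ (σ ⊗ 1) u` is the rational vector `1 ⊗ θ(u)`, `θ` the trace contraction. -/
theorem sum_rTensor_eq_tmul_traceContract (u : K ⊗[F₀] V) :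
    ∑ σ : K ≃ₐ[F₀] K, LinearMap.rTensor V σ.toLinearMap u =
      (1 : K) ⊗ₜ[F₀] TensorProduct.lift ((LinearMap.lsmul F₀ V).comp (Algebra.trace F₀ K)) u := by
  induction u using TensorProduct.induction_on with
  | zero => simp
  | tmul c v =>
    simp only [LinearMap.rTensor_tmul, AlgEquiv.toLinearMap_apply, lift_lsmul_comp_trace_tmul]
    rw [← TensorProduct.sum_tmul, ← trace_eq_sum_automorphisms, Algebra.algebraMap_eq_smul_one,
      TensorProduct.smul_tmul]
  | add x y hx hy => simp only [map_add, Finset.sum_add_distrib, hx, hy, TensorProduct.tmul_add]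

/-- **Reconstruction from the traces**: with `k` a basis of `K/F₀` and `k^*` its trace-dual basis,
`u = Σ_j k^*_j • (1 ⊗ θ(k_j • u))` for every `u ∈ K ⊗[F₀] V`. -/
theorem eq_sum_traceDual_smul_tmul_traceContract {ι : Type*} [Fintype ι] [DecidableEq ι]
    (k : Module.Basis ι F₀ K) (u : K ⊗[F₀] V) :
    u = ∑ j, k.traceDual j •
      ((1 : K) ⊗ₜ[F₀] TensorProduct.lift ((LinearMap.lsmul F₀ V).comp (Algebra.trace F₀ K)) (k j • u)) := by
  induction u using TensorProduct.induction_on with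
  | zero => simp
  | tmul c v =>
    have key : ∀ j, k.traceDual j •
        ((1 : K) ⊗ₜ[F₀] TensorProduct.lift ((LinearMap.lsmul F₀ V).comp (Algebra.trace F₀ K)) (k j • c ⊗ₜ[F₀] v)) =
        (Algebra.trace F₀ K (k j * c) • k.traceDual j) ⊗ₜ[F₀] v := by
      intro j
      rw [TensorProduct.smul_tmul' (k j) c v, smul_eq_mul, lift_lsmul_comp_trace_tmul, TensorProduct.tmul_smul,
        smul_comm (k.traceDual j), TensorProduct.smul_tmul' (k.traceDual j) (1 : K) v, smul_eq_mul, mul_one,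
        TensorProduct.smul_tmul']
    simp only [key, ← TensorProduct.sum_tmul]
    congr 1
    conv_lhs => rw [← k.traceDual.sum_repr c]
    refine Finset.sum_congr rfl fun j _ => ?_
    rw [Module.Basis.traceDual_repr_apply, Algebra.traceForm_apply, mul_comm]
  | add x y hx hy =>
    simp only [smul_add, map_add, TensorProduct.tmul_add, Finset.sum_add_distrib]
    exact congr_arg₂ (· + ·) hx hy

/-- **Galois descent of subspaces** (Speiser): a `K`-subspace `U` of `K ⊗[F₀] V` stable under every `σ ⊗ 1`,
`σ ∈ Gal(K/F₀)`, is the base change of its rational part `U₀ = {v ∈ V : 1 ⊗ v ∈ U}`. -/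
theorem baseChange_rationalPart_eq (U : Submodule K (K ⊗[F₀] V))
    (hU : ∀ (σ : K ≃ₐ[F₀] K), ∀ u ∈ U, LinearMap.rTensor V σ.toLinearMap u ∈ U) :
    ((U.restrictScalars F₀).comap (TensorProduct.mk F₀ K V 1)).baseChange K = U := by
  classical
  refine le_antisymm ?_ ?_
  · rw [Submodule.baseChange_eq_span, Submodule.span_le]
    rintro _ ⟨v, hv, rfl⟩
    exact hv
  · intro u hu
    let k := Module.finBasis F₀ K
    rw [eq_sum_traceDual_smul_tmul_traceContract k u]
    refine Submodule.sum_mem _ fun j _ => Submodule.smul_mem _ _ ?_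
    refine Submodule.tmul_mem_baseChange_of_mem 1 ?_
    show (1 : K) ⊗ₜ[F₀] TensorProduct.lift ((LinearMap.lsmul F₀ V).comp (Algebra.trace F₀ K)) (k j • u) ∈ U
    rw [← sum_rTensor_eq_tmul_traceContract]
    exact Submodule.sum_mem _ fun σ _ => hU σ _ (U.smul_mem _ hu)

/-- A Galois-stable `K`-subspace of `K ⊗[F₀] V` is the base change of some `F₀`-subspace of `V`. -/
theorem exists_baseChange_eq_of_forall_rTensor_mem (U : Submodule K (K ⊗[F₀] V))
    (hU : ∀ (σ : K ≃ₐ[F₀] K), ∀ u ∈ U, LinearMap.rTensor V σ.toLinearMap u ∈ U) :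
    ∃ W : Submodule F₀ V, W.baseChange K = U :=
  ⟨_, baseChange_rationalPart_eq U hU⟩

omit [FiniteDimensional F₀ K] [IsGalois F₀ K] in
/-- Conversely, every base change is Galois-stable, so «Galois-stable» characterises the base changes. -/
theorem forall_rTensor_mem_baseChange (W : Submodule F₀ V) (σ : K ≃ₐ[F₀] K) :
    ∀ u ∈ W.baseChange K, LinearMap.rTensor V σ.toLinearMap u ∈ W.baseChange K := by
  intro u hu
  rw [Submodule.baseChange_eq_span] at hu ⊢
  refine Submodule.span_induction ?_ ?_ ?_ ?_ hu
  · rintro _ ⟨v, hv, rfl⟩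
    have h1 : LinearMap.rTensor V σ.toLinearMap ((TensorProduct.mk F₀ K V 1) v) =
        (TensorProduct.mk F₀ K V 1) v := by
      simp
    rw [h1]
    exact Submodule.subset_span ⟨v, hv, rfl⟩
  · simp
  · intro x y _ _ hx hy
    rw [map_add]
    exact Submodule.add_mem _ hx hy
  · intro a x _ hx
    rw [rTensor_smul]
    exact Submodule.smul_mem _ _ hx

end HodgeRepro.Tier3
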